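/-
Copyright: lit-balaban cell, Phase-2 proof seat p02 (gen 8).  Statement-level skeleton of a published paper; no proof claims beyond what
the kernel checks below.
-/
import Literature.MathematicalPhysics.QuantumFieldTheory.BalabanImbrieJaffe1984to88.BIJ88W1HkPart544Torus

/-!
# `BalabanImbrieJaffe1984to88.BIJ88W1HkPart544DivTorus` — T. Bałaban, J. Imbrie, A. Jaffe, *Effective action and cluster properties of the
abelian Higgs model*, Commun. Math. Phys. **114** (1988) 257–315 [BalabanImbrieJaffe1988]: p. 282 [PDF 26], **THE `∂*` MEMBER FOR THE `H`-PART
`K = H_k□ − H_{k,loc}` OF `w₁` (5.4.4) ON THE TORI OF THE SERIES, ALL TORI, HYPOTHESIS-FREE** — the third of the three bounds *"|(∂w′₁)(p,b′)| ≦ …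
e^{−cr(e_k)}e^{−c dist(p,b′)}, and similarly for w′₁, ∂*w′₁ … w₁ = w′₁ + H_k□ − H_{k,loc} … satisfies the same bounds as w′₁"*, completing the
sibling `BIJ88W1HkPart544Torus` (entry and `∂` members, p308749): `|(∂^{η*}K(·,b′))(x)| ≤ e^{−cr}e^{−c dist(x,b′)}` on the sites `x ∈ □₀`, in
r16's typed shape `Ineq547 (TSite P 0) (PBond P k) (χ₀·∂^{η*}K) dist c r`, and the THREE members together with ONE `(c, r₁)` for every torus
(`P.d = d`, `P.L = L`) and every `k ≤ m + K`.

statement-level skeleton of published theorems with citation tags; proofs where landed; nothing here is a claim about the Yang–Mills mass gap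

PDF held: `paper:balaban1988-cmp114-bij-abelian-higgs-effective-action` (journal page = PDF page + 256); p. 282 [PDF 26] read this session AS AN
IMAGE (`HOME/lit-balaban-r16/renders/cmp114/original-p026-x2.png`).

CITATION HEADER (lean-in-tree rule).  Part of the lit-balaban TYPED SKELETON (HOME `run/shared/lean/pub/lit-balaban/`), Phase-2 proof seat
p02 (gen 8), unit `lit-balaban-p02-g8`; WHAT IS REPRODUCED = member «w₁ satisfies the same bounds as w′₁» (`H`-part, `∂*` member) of SKELETON
row **C2.Eq5.4.7** (owner r16, referee ref-5; r16's list 21:31:33Z item (1)).  Decls of record used BY NAME: the sibling's `rem_term_le_decay`,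
`abs_hkPart_le`, `abs_curl_hkPart_le` (p308749); p306809's `exists_lipschitz_cutoffProfile`/`lip_cutoff_torus`; r18 g10's
`exists_gradB_allTori_of_prop12Printed`; p16/p19's `exists_absH_le_allTori_of_prop12Printed`/`abs_H_zero_le`/`prop12Printed_allTori`; p08 g7's
`curl_HkE_single_eq`, `ofLp_HkE_single_bond`; p13's `cutoff`/`isCutoff_cutoff`/`cutoff_mem_Icc`; the shared `diverg` (backward divergence
`(∂^{η*}A)(x) = η⁻¹Σ_μ(A(x − e_μ, μ) − A(x, μ))` of `LatticeFieldCalculus`); r16's `Ineq547`.  TAKING line HOME/STATUS.md (gen 8, eighth file).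

THE MECHANISM (`∂*`): per direction `μ`, discrete Leibniz for the backward difference of `(χ□(b′) − ζ_k(·,b′))H_k(·,b′)` between the bonds
`⟨x − e_μ, μ⟩` and `⟨x, μ⟩`: the main term `(χ□ − ζ_k(⟨x,μ⟩))·η⁻¹(H_k(⟨x−e_μ,μ⟩,b′) − H_k(⟨x,μ⟩,b′))` is a GRADIENT component of (I.7.2.2) at base
`x − e_μ` (`(x − e_μ) + e_μ = x`), bounded by `Me^{−δ dist(x−e_μ,b′)} ≤ Me^{δ}e^{−δ dist(x,b′)}` and supported at `dist(x,b′) ≥ r/16`; the remainder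
`η⁻¹(ζ_k(⟨x,μ⟩) − ζ_k(⟨x−e_μ,μ⟩))H_k(⟨x−e_μ,μ⟩,b′)` is the sibling's `rem_term_le_decay`; `d` directions.

WHAT IS PROVED (0 `sorry`, standard axioms; theorems only — proof lane):
* §1 generic: **`abs_diverg_hkPart_le`** — `|(∂^{η*}K(·,b′))(x)| ≤ d(1 + K)Me^{δ}·e^{−(δ/2)(r/16)}e^{−(δ/2)dist(x,b′)}` for `χ₀(x) ≠ 0` (hypotheses as in
  the sibling, with the gradient member `|η⁻¹(H(⟨y+e_λ,ν⟩,b′) − H(⟨y,ν⟩,b′))| ≤ Me^{−δ dist(y,b′)}` in place of the curl member).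
* §2 **`ineq547_w1HkPart3_allTori`** — `∃ c > 0, r₁` such that for EVERY torus (`P.d = d`, `P.L = L`), EVERY `k ≤ m + K`, `c′ ≠ 0`, `w > 0`,
  `r ≥ r₁`, `|χ□| ≤ 1`, `|χ₀| ≤ 1` with the collar clause: r16's `Ineq547` for `χ₀·K` (entry), `χ₀·∂^ηK` (curl) AND `χ₀·∂^{η*}K` (divergence),
  hypothesis-free (`1 ≤ d`, `L` odd `> 1`, `a > 0`).
HONEST SCOPE.  As the sibling: only the `H`-part of `w₁` (the `w′₁` tails are p08's lane); `□₀ ⊂ □` by the collar clause; constants explicit;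
`U = 1` real abelian fields; no `def`, no new named fact; NOT summit progress.  Unit `lit-balaban-p02-g8` (literature-prover-lit-balaban-p02-g8-0),
2026-08-21.
-/

open scoped BigOperators RealInnerProductSpace

namespace Literature.MathematicalPhysics.QuantumFieldTheory.BalabanImbrieJaffe1984to88.BIJ88W1HkPart544DivTorus

open Balaban1983to89 hiding Site Plaq
open Balaban1983to89.LatticeFieldCalculus
open Balaban1983to89.B3TorusRadialSums (supDist_comm)
open BIJ85Prop521Torus BIJ85Sigma421Torus BIJ85Prop522Torus
open BIJ85Sect7Statements BIJ85Ineq722Torus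
open BIJ85Ineq722DeltaA (deltaAData)
open BIJ88Sect2Statements (loc IsCutoff)
open BIJ88Sect5StatementsPart2 (Ineq547)
open BIJ88Cutoffs21 (cutoff isCutoff_cutoff cutoff_mem_Icc)
open BIJ88Ineq217Ineq722Torus (curl_HkE_single_eq)
open BIJ88HkLocTorus (ofLp_HkE_single_bond)
open BIJ85Sect72AllTori (exists_absH_le_allTori_of_prop12Printed abs_H_zero_le)
open BIJ85Prop12AllTori (prop12Printed_allTori)
open BIJ88Sect2SigmaAllTori (exists_gradB_allTori_of_prop12Printed)
open BIJ88Ineq555W3CorrMechanism (exists_lipschitz_cutoffProfile lip_cutoff_torus)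
open BIJ88W1HkPart544Torus (rem_term_le_decay abs_hkPart_le abs_curl_hkPart_le)

open Balaban1983to89 renaming Site → TSite, Plaq → TPlaq

noncomputable section

variable {P : Params}

/-! ## §0  Plumbing -/

/-- `(x − e_μ) + e_μ = x`. [folklore] -/
private theorem shift_unshift' {j : ℕ} (x : TSite P j) (μ : Fin P.d) : (x.unshift μ).shift μ = x :=
  (shiftEquiv (P := P) (j := j) μ).apply_symm_apply x

/-- `|x − (x − e_μ)|_∞ ≤ 1`. [folklore] -/
private theorem supDist_unshift_le {j : ℕ} (x : TSite P j) (μ : Fin P.d) : supDist x (x.unshift μ) ≤ 1 := by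
  have h := supDist_runSite_le (x.unshift μ) μ 1
  have h2 : runSite (x.unshift μ) μ 1 = x := by
    have h3 : runSite (x.unshift μ) μ 1 = (x.unshift μ).shift μ := by
      show Function.update (x.unshift μ) μ ((x.unshift μ) μ + ((1 : ℕ) : ZMod _)) = Function.update (x.unshift μ) μ ((x.unshift μ) μ + 1)
      rw [Nat.cast_one]
    rw [h3, shift_unshift']
  rw [h2, supDist_comm] at h
  exact h

/-- `1/L^k ≤ 1`. [folklore] -/
private theorem one_div_pow_L_le_one (k : ℕ) : 1 / (P.L : ℝ) ^ k ≤ 1 := by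
  have hL1 : (1 : ℝ) ≤ (P.L : ℝ) := by exact_mod_cast P.L_pos
  rw [div_le_one (by positivity)]
  exact one_le_pow₀ hL1

/-- `0 ≤ dist(x, y)`. [folklore] -/
private theorem distEU_nonneg' (k : ℕ) (x : TSite P 0) (y : TSite P k) : 0 ≤ distEU P k x y :=
  div_nonneg (Nat.cast_nonneg _) (pow_nonneg (Nat.cast_nonneg _) _)

/-- splitting the decay: `e^{−δt} ≤ e^{−(δ/2)s}e^{−(δ/2)u}` for `s, u ≤ t`, `δ ≥ 0`. [folklore] -/
private theorem exp_split {δ t s u : ℝ} (hδ : 0 ≤ δ) (hs : s ≤ t) (hu : u ≤ t) :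
    Real.exp (-(δ * t)) ≤ Real.exp (-(δ / 2 * s)) * Real.exp (-(δ / 2 * u)) := by
  rw [← Real.exp_add]
  exact Real.exp_le_exp.2 (by nlinarith)

/-! ## §1  The `∂*` member for `K = H_k□ − H_{k,loc}` on the sites of `□₀` -/

/-- **`|(∂^{η*}K(·,b′))(x)| ≤ d(1 + K)Me^{δ}·e^{−(δ/2)(r/16)}·e^{−(δ/2)dist(x,b′)}` on the sites of `□₀`** — *"and similarly for … ∂*w′₁ … [w₁] satisfies
the same bounds"*, the `H`-part: per direction the backward-difference Leibniz rule, main term by the gradient member of (I.7.2.2) at base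
`x − e_μ`, remainder by `rem_term_le_decay`. [cite: BalabanImbrieJaffe1988, (5.4.4) p.282] -/
theorem abs_diverg_hkPart_le {k : ℕ} {H : PBond P k → VecField P 0 ℝ} {δ M : ℝ} (hδ : 0 ≤ δ) (hM : 0 ≤ M)
    (hH : ∀ b' b, |H b' b| ≤ M * Real.exp (-(δ * distEU P k b.src b'.src)))
    (hgrad : ∀ (b' : PBond P k) (y : TSite P 0) (lam ν : Fin P.d),
      |(P.L : ℝ) ^ k * (H b' ⟨y.shift lam, ν⟩ - H b' ⟨y, ν⟩)| ≤ M * Real.exp (-(δ * distEU P k y b'.src)))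
    {r K : ℝ} (hr : 0 < r) (hK : 0 ≤ K) {ζ : PBond P 0 → PBond P k → ℝ}
    (hcut : IsCutoff (fun (b : PBond P 0) (b' : PBond P k) => distEU P k b.src b'.src) ζ (r / 16) (r / 8))
    (h01 : ∀ b b', 0 ≤ ζ b b' ∧ ζ b b' ≤ 1)
    (hLipζ : ∀ (x x' : TSite P 0) (lam lam' : Fin P.d) (b' : PBond P k), supDist x x' ≤ 1 →
      (P.L : ℝ) ^ k * |ζ ⟨x, lam⟩ b' - ζ ⟨x', lam'⟩ b'| ≤ K)
    {χb : PBond P k → ℝ} (hχb : ∀ b', |χb b'| ≤ 1) {χ₀ : TSite P 0 → ℝ}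
    (hbox : ∀ (x : TSite P 0) (b' : PBond P k), χ₀ x ≠ 0 → distEU P k x b'.src ≤ r / 8 + 2 → χb b' = 1)
    {x : TSite P 0} (hx : χ₀ x ≠ 0) (b' : PBond P k) :
    |diverg ((P.L : ℝ) ^ k) (fun b => H b' b * χb b' - loc ζ (fun b b'' => H b'' b) b b') x| ≤
      (P.d : ℝ) * ((1 + K) * M * Real.exp δ) * Real.exp (-(δ / 2 * (r / 16))) * Real.exp (-(δ / 2 * distEU P k x b'.src)) := by
  set E := Real.exp (-(δ / 2 * (r / 16))) * Real.exp (-(δ / 2 * distEU P k x b'.src)) with hE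
  have hL : (0 : ℝ) < (P.L : ℝ) ^ k := by have := P.L_pos; positivity
  -- per direction
  have hμ : ∀ μ : Fin P.d,
      |(P.L : ℝ) ^ k • ((H b' ⟨x.unshift μ, μ⟩ * χb b' - loc ζ (fun b b'' => H b'' b) ⟨x.unshift μ, μ⟩ b') -
          (H b' ⟨x, μ⟩ * χb b' - loc ζ (fun b b'' => H b'' b) ⟨x, μ⟩ b'))| ≤ (1 + K) * M * Real.exp δ * E := by
    intro μ
    set y := x.unshift μ with hy
    have hyx : y.shift μ = x := shift_unshift' x μ
    have hxy1 : supDist x y ≤ 1 := supDist_unshift_le x μ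
    -- Leibniz: c(f⁻g⁻ − f⁰g⁰) = f⁰·c(g⁻ − g⁰) + c(f⁻ − f⁰)·g⁻ with f = χ□ − ζ, g = H
    have eL : (P.L : ℝ) ^ k • ((H b' ⟨y, μ⟩ * χb b' - loc ζ (fun b b'' => H b'' b) ⟨y, μ⟩ b') -
          (H b' ⟨x, μ⟩ * χb b' - loc ζ (fun b b'' => H b'' b) ⟨x, μ⟩ b')) =
        (χb b' - ζ ⟨x, μ⟩ b') * ((P.L : ℝ) ^ k * (H b' ⟨y, μ⟩ - H b' ⟨x, μ⟩)) +
          (P.L : ℝ) ^ k * (ζ ⟨x, μ⟩ b' - ζ ⟨y, μ⟩ b') * H b' ⟨y, μ⟩ := by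
      simp only [loc, smul_eq_mul]; ring
    rw [eL]
    -- the gradient component at base `y = x − e_μ`, moved to `x`
    have hg : |(P.L : ℝ) ^ k * (H b' ⟨y, μ⟩ - H b' ⟨x, μ⟩)| ≤ M * Real.exp δ * Real.exp (-(δ * distEU P k x b'.src)) := by
      have h1 := hgrad b' y μ μ
      rw [hyx] at h1
      have e : (P.L : ℝ) ^ k * (H b' ⟨y, μ⟩ - H b' ⟨x, μ⟩) = -((P.L : ℝ) ^ k * (H b' ⟨x, μ⟩ - H b' ⟨y, μ⟩)) := by ring
      rw [e, abs_neg]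
      refine h1.trans ?_
      rw [mul_assoc]
      refine mul_le_mul_of_nonneg_left ?_ hM
      rw [← Real.exp_add]
      refine Real.exp_le_exp.2 ?_
      have hD := BIJ88Ineq555W3CorrMechanism.abs_distEU_sub_le_of_supDist_le_one hxy1 b'.src
      rw [abs_le] at hD
      have h5 : distEU P k x b'.src - distEU P k y b'.src ≤ 1 := by linarith [hD.1, one_div_pow_L_le_one (P := P) k]
      nlinarith [mul_le_mul_of_nonneg_left h5 hδ]
    -- main term
    have T1 : |(χb b' - ζ ⟨x, μ⟩ b') * ((P.L : ℝ) ^ k * (H b' ⟨y, μ⟩ - H b' ⟨x, μ⟩))| ≤ M * Real.exp δ * E := by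
      rw [abs_mul]
      have key : ∀ {f : ℝ}, |f| ≤ 1 → (f = 0 ∨ r / 16 ≤ distEU P k x b'.src) →
          |f| * |(P.L : ℝ) ^ k * (H b' ⟨y, μ⟩ - H b' ⟨x, μ⟩)| ≤ M * Real.exp δ * E := by
        intro f hf hor
        rcases hor with h0 | hfar
        · rw [h0, abs_zero, zero_mul]; positivity
        · calc |f| * |(P.L : ℝ) ^ k * (H b' ⟨y, μ⟩ - H b' ⟨x, μ⟩)| ≤ 1 * (M * Real.exp δ * Real.exp (-(δ * distEU P k x b'.src))) :=
                mul_le_mul hf hg (abs_nonneg _) zero_le_one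
            _ ≤ M * Real.exp δ * E := by
                rw [one_mul, hE]; exact mul_le_mul_of_nonneg_left (exp_split hδ hfar le_rfl) (by positivity)
      by_cases h1 : χb b' = 1
      · refine key ?_ ?_
        · rw [h1, abs_le]; constructor <;> linarith [(h01 ⟨x, μ⟩ b').1, (h01 ⟨x, μ⟩ b').2]
        · by_cases hle : distEU P k x b'.src ≤ r / 16
          · left; rw [h1, hcut.1 ⟨x, μ⟩ b' hle, sub_self]
          · right; exact (not_le.1 hle).le
      · have hfar : r / 8 + 2 < distEU P k x b'.src := by
          by_contra hcon
          exact h1 (hbox x b' hx (not_lt.1 hcon))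
        have hz : ζ ⟨x, μ⟩ b' = 0 := hcut.2 ⟨x, μ⟩ b' (by show r / 8 ≤ distEU P k x b'.src; linarith)
        rw [hz, sub_zero]
        exact key (hχb b') (Or.inr (by linarith))
    -- remainder term
    have T2 : |(P.L : ℝ) ^ k * (ζ ⟨x, μ⟩ b' - ζ ⟨y, μ⟩ b') * H b' ⟨y, μ⟩| ≤ K * M * Real.exp δ * E := by
      rw [abs_mul, abs_mul, abs_of_pos hL, hE, ← mul_assoc (K * M * Real.exp δ)]
      exact rem_term_le_decay hδ hM hK hcut (hLipζ x y μ μ b' hxy1) hxy1 (hH b' ⟨y, μ⟩)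
    refine (abs_add_le _ _).trans ?_
    have e3 : (1 + K) * M * Real.exp δ * E = M * Real.exp δ * E + K * M * Real.exp δ * E := by ring
    rw [e3]
    exact add_le_add T1 T2
  -- sum over the `d` directions
  unfold diverg
  refine (Finset.abs_sum_le_sum_abs _ _).trans ?_
  calc ∑ μ : Fin P.d, |(P.L : ℝ) ^ k • ((H b' ⟨x.unshift μ, μ⟩ * χb b' - loc ζ (fun b b'' => H b'' b) ⟨x.unshift μ, μ⟩ b') -
          (H b' ⟨x, μ⟩ * χb b' - loc ζ (fun b b'' => H b'' b) ⟨x, μ⟩ b'))|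
      ≤ ∑ _μ : Fin P.d, (1 + K) * M * Real.exp δ * E := Finset.sum_le_sum fun μ _ => hμ μ
    _ = (P.d : ℝ) * ((1 + K) * M * Real.exp δ) * Real.exp (-(δ / 2 * (r / 16))) * Real.exp (-(δ / 2 * distEU P k x b'.src)) := by
        rw [Finset.sum_const, Finset.card_univ, Fintype.card_fin, nsmul_eq_mul, hE]; ring

/-! ## §2  On the tori for the kernels of record: the three members, all tori, hypothesis-free -/

/-- `A ≤ γt ⟹ Ae^{−2γt} ≤ e^{−γt}`. [folklore] -/
private theorem small_of_le_mul {A γ t : ℝ} (h : A ≤ γ * t) : A * Real.exp (-(2 * γ * t)) ≤ Real.exp (-(γ * t)) := by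
  have h1 : A ≤ Real.exp (γ * t) := h.trans (by linarith [Real.add_one_le_exp (γ * t)])
  have e : Real.exp (-(2 * γ * t)) = Real.exp (-(γ * t)) * Real.exp (-(γ * t)) := by rw [← Real.exp_add]; ring_nf
  rw [e, ← mul_assoc]
  have h2 : A * Real.exp (-(γ * t)) ≤ 1 := by
    have h3 := mul_le_mul_of_nonneg_right h1 (Real.exp_pos (-(γ * t))).le
    rwa [← Real.exp_add, show γ * t + -(γ * t) = 0 by ring, Real.exp_zero] at h3
  calc A * Real.exp (-(γ * t)) * Real.exp (-(γ * t)) ≤ 1 * Real.exp (-(γ * t)) :=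
        mul_le_mul_of_nonneg_right h2 (Real.exp_pos _).le
    _ = _ := one_mul _

/-- from a bound `|χ₀·X| ≤ … ≤ A·E₁·e^{−(δ/2)dist}` to r16's `e^{−cr}e^{−c dist}` with `c = δ/64`. [folklore] -/
private theorem member_of_bound {δ r A B t X χ : ℝ} (hδ : 0 < δ) (hA : A * Real.exp (-(δ / 2 * (r / 16))) ≤ Real.exp (-(δ / 64 * r)))
    (hBA : B ≤ A) (ht : 0 ≤ t) (hχ : |χ| ≤ 1)
    (hX : χ ≠ 0 → |X| ≤ B * Real.exp (-(δ / 2 * (r / 16))) * Real.exp (-(δ / 2 * t))) :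
    |χ * X| ≤ Real.exp (-(δ / 64 * r)) * Real.exp (-(δ / 64 * t)) := by
  rw [abs_mul]
  by_cases h0 : χ = 0
  · rw [h0, abs_zero, zero_mul]; positivity
  · have hdecay : Real.exp (-(δ / 2 * t)) ≤ Real.exp (-(δ / 64 * t)) := Real.exp_le_exp.2 (by nlinarith)
    calc |χ| * |X| ≤ 1 * (B * Real.exp (-(δ / 2 * (r / 16))) * Real.exp (-(δ / 2 * t))) :=
          mul_le_mul hχ (hX h0) (abs_nonneg _) zero_le_one
      _ ≤ A * Real.exp (-(δ / 2 * (r / 16))) * Real.exp (-(δ / 64 * t)) := by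
          rw [one_mul]
          have hB : 0 ≤ B * Real.exp (-(δ / 2 * (r / 16))) := by
            have := (abs_nonneg X).trans (hX h0)
            have hpos : 0 < Real.exp (-(δ / 2 * t)) := Real.exp_pos _
            by_contra hneg
            rw [not_le] at hneg
            have := mul_neg_of_neg_of_pos hneg hpos
            linarith
          exact mul_le_mul (mul_le_mul_of_nonneg_right hBA (Real.exp_pos _).le) hdecay (Real.exp_pos _).le
            (hB.trans (mul_le_mul_of_nonneg_right hBA (Real.exp_pos _).le))
      _ ≤ Real.exp (-(δ / 64 * r)) * Real.exp (-(δ / 64 * t)) := mul_le_mul_of_nonneg_right hA (Real.exp_pos _).le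

/-- **THE `H`-PART OF `w₁` ON THE TORI OF THE SERIES — ENTRY, `∂` AND `∂*` MEMBERS, ALL TORI, HYPOTHESIS-FREE** (`1 ≤ d`, `L` odd `> 1`, `a > 0`):
ONE `c > 0` and ONE threshold `r₁` such that for EVERY torus `P` (`P.d = d`, `P.L = L`), EVERY `k ≤ m + K`, every `c′ ≠ 0`, `w > 0`, `r ≥ r₁`,
`|χ□| ≤ 1`, `|χ₀| ≤ 1` with the collar clause `χ₀(x) ≠ 0 ⟹ dist(x,b′) ≤ r/8 + 2 ⟹ χ□(b′) = 1`, for `K = H_k□ − H_{k,loc}` (`H_k` = p11's `HkE` kernel,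
`ζ_k` = p13's (2.1) cutoff `cutoff (r/16) (r/8) dist`): r16's `Ineq547` for `χ₀(b₋)·K(b,b′)` on `PBond P 0`, for `χ₀(q₋)·(∂^ηK(·,b′))(q)` on
`TPlaq P 0`, and for `χ₀(x)·(∂^{η*}K(·,b′))(x)` on `TSite P 0` — *"w₁ … satisfies the same bounds as w′₁"* (`w′₁`, `∂w′₁`, `∂*w′₁`), `c = δ/64`.
[cite: BalabanImbrieJaffe1988, (5.4.4) p.282] -/
theorem ineq547_w1HkPart3_allTori {d L : ℕ} (hd : 1 ≤ d) (hL : Odd L ∧ 1 < L) {a : ℝ} (ha : 0 < a) :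
    ∃ c r₁ : ℝ, 0 < c ∧ ∀ (P : Params) (_ : P.d = d) (_ : P.L = L) (k : ℕ) (_ : k ≤ P.m + P.K) (c' : ℝ), c' ≠ 0 →
      ∀ (w : ℝ), 0 < w → ∀ (r : ℝ), r₁ ≤ r → ∀ (χb : PBond P k → ℝ), (∀ b', |χb b'| ≤ 1) →
      ∀ (χ₀ : TSite P 0 → ℝ), (∀ x, |χ₀ x| ≤ 1) →
      (∀ (x : TSite P 0) (b' : PBond P k), χ₀ x ≠ 0 → distEU P k x b'.src ≤ r / 8 + 2 → χb b' = 1) →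
        Ineq547 (PBond P 0) (PBond P k)
            (fun b b' => χ₀ b.src *
              (WithLp.ofLp (HkE P w c' k (toEj P k (Pi.single b' 1))) b * χb b' -
                loc (cutoff (r / 16) (r / 8) (fun (b : PBond P 0) (b' : PBond P k) => distEU P k b.src b'.src))
                  (fun b b'' => WithLp.ofLp (HkE P w c' k (toEj P k (Pi.single b'' 1))) b) b b'))
            (fun b b' => distEU P k b.src b'.src) c r ∧
          Ineq547 (TPlaq P 0) (PBond P k)
            (fun q b' => χ₀ q.src *
              curl ((P.L : ℝ) ^ k) (fun b =>
                WithLp.ofLp (HkE P w c' k (toEj P k (Pi.single b' 1))) b * χb b' -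
                  loc (cutoff (r / 16) (r / 8) (fun (b : PBond P 0) (b' : PBond P k) => distEU P k b.src b'.src))
                    (fun b b'' => WithLp.ofLp (HkE P w c' k (toEj P k (Pi.single b'' 1))) b) b b') q)
            (fun q b' => distEU P k q.src b'.src) c r ∧
          Ineq547 (TSite P 0) (PBond P k)
            (fun x b' => χ₀ x *
              diverg ((P.L : ℝ) ^ k) (fun b =>
                WithLp.ofLp (HkE P w c' k (toEj P k (Pi.single b' 1))) b * χb b' -
                  loc (cutoff (r / 16) (r / 8) (fun (b : PBond P 0) (b' : PBond P k) => distEU P k b.src b'.src))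
                    (fun b b'' => WithLp.ofLp (HkE P w c' k (toEj P k (Pi.single b'' 1))) b) b b') x)
            (fun x b' => distEU P k x b'.src) c r := by
  have h12 := prop12Printed_allTori d L ha
  obtain ⟨δg, Mg, hδg, hMg, hG⟩ := exists_gradB_allTori_of_prop12Printed hd hL ha h12
  obtain ⟨δh, Mh, hδh, hMh, hH1⟩ := exists_absH_le_allTori_of_prop12Printed hd hL ha h12
  obtain ⟨C, hC, hLip₀⟩ := exists_lipschitz_cutoffProfile
  set δ := min δg δh with hδdef
  set M := max Mg Mh with hMdef
  have hδ : 0 < δ := lt_min hδg hδh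
  have hM1 : 1 ≤ M := hMh.trans (le_max_right _ _)
  have hM0 : 0 ≤ M := zero_le_one.trans hM1
  set A := (2 + 3 * C * Real.exp δ) * M + (d : ℝ) * ((1 + C) * M * Real.exp δ) with hAdef
  have hA1 : (2 + 3 * C * Real.exp δ) * M ≤ A := by
    have : 0 ≤ (d : ℝ) * ((1 + C) * M * Real.exp δ) := by positivity
    linarith
  have hA2 : (d : ℝ) * ((1 + C) * M * Real.exp δ) ≤ A := by
    have : 0 ≤ (2 + 3 * C * Real.exp δ) * M := by positivity
    linarith
  have hMA : M ≤ A := by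
    have : (1 : ℝ) ≤ 2 + 3 * C * Real.exp δ := by nlinarith [Real.exp_pos δ, hC.le]
    nlinarith
  have hA : 0 ≤ A := hM0.trans hMA
  refine ⟨δ / 64, max 16 (64 * A / δ), by positivity, ?_⟩
  intro P hPd hPL k hk c' hc' w hw r hr χb hχb χ₀ hχ₀ hbox
  have hr16 : 16 ≤ r := (le_max_left _ _).trans hr
  have hrA : 64 * A / δ ≤ r := (le_max_right _ _).trans hr
  have hr0 : 0 < r := by linarith
  have hAr : A ≤ δ / 64 * r := by rw [div_le_iff₀ hδ] at hrA; linarith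
  have hexp : ∀ {δ₁ : ℝ} {t : ℝ}, δ ≤ δ₁ → 0 ≤ t → Real.exp (-(δ₁ * t)) ≤ Real.exp (-(δ * t)) := fun h ht =>
    Real.exp_le_exp.2 (by nlinarith)
  -- the `|H|` member (scale 0: `H₀ = I`)
  have hH : ∀ (b' : PBond P k) (b : PBond P 0),
      |WithLp.ofLp (HkE P w c' k (toEj P k (Pi.single b' 1))) b| ≤ M * Real.exp (-(δ * distEU P k b.src b'.src)) := by
    intro b' b
    rw [ofLp_HkE_single_bond hk hc' hw ha b b']
    rcases Nat.eq_zero_or_pos k with hk0 | hk1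
    · subst hk0
      exact abs_H_zero_le hk ha hM1 δ b.dir b'.dir b.src b'.src
    · calc |(torusRep P k (deltaAData hk a)).H (b.src, b.dir) (b'.src, b'.dir)|
          ≤ Mh * Real.exp (-(δh * distEU P k b.src b'.src)) := hH1 P hPd hPL k hk1 hk b.dir b'.dir b.src b'.src
        _ ≤ M * Real.exp (-(δ * distEU P k b.src b'.src)) :=
            mul_le_mul (le_max_right _ _) (hexp (min_le_right _ _) (distEU_nonneg' k _ _)) (Real.exp_pos _).le hM0
  -- the gradient member, componentwise
  have hgrad : ∀ (b' : PBond P k) (y : TSite P 0) (lam ν : Fin P.d),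
      |(P.L : ℝ) ^ k * (WithLp.ofLp (HkE P w c' k (toEj P k (Pi.single b' 1))) ⟨y.shift lam, ν⟩ -
        WithLp.ofLp (HkE P w c' k (toEj P k (Pi.single b' 1))) ⟨y, ν⟩)| ≤ M * Real.exp (-(δ * distEU P k y b'.src)) := by
    intro b' y lam ν
    rw [ofLp_HkE_single_bond hk hc' hw ha ⟨y.shift lam, ν⟩ b', ofLp_HkE_single_bond hk hc' hw ha ⟨y, ν⟩ b']
    have h1 := norm_le_pi_norm (fun lam : Fin P.d => (P.L : ℝ) ^ k *
      ((torusRep P k (deltaAData hk a)).H (y.shift lam, ν) (b'.src, b'.dir) -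
        (torusRep P k (deltaAData hk a)).H (y, ν) (b'.src, b'.dir))) lam
    rw [Real.norm_eq_abs] at h1
    refine h1.trans ((hG P hPd hPL k hk ν b'.dir y b'.src).trans ?_)
    exact mul_le_mul (le_max_left _ _) (hexp (min_le_left _ _) (distEU_nonneg' k _ _)) (Real.exp_pos _).le hM0
  -- the curl member from the gradient member
  have hcurl : ∀ (b' : PBond P k) (q : TPlaq P 0),
      |curl ((P.L : ℝ) ^ k) (WithLp.ofLp (HkE P w c' k (toEj P k (Pi.single b' 1)))) q| ≤
        2 * M * Real.exp (-(δ * distEU P k q.src b'.src)) := by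
    intro b' q
    have e : curl ((P.L : ℝ) ^ k) (WithLp.ofLp (HkE P w c' k (toEj P k (Pi.single b' 1)))) q =
        (P.L : ℝ) ^ k * (WithLp.ofLp (HkE P w c' k (toEj P k (Pi.single b' 1))) ⟨q.src.shift q.μ, q.ν⟩ -
            WithLp.ofLp (HkE P w c' k (toEj P k (Pi.single b' 1))) ⟨q.src, q.ν⟩) -
          (P.L : ℝ) ^ k * (WithLp.ofLp (HkE P w c' k (toEj P k (Pi.single b' 1))) ⟨q.src.shift q.ν, q.μ⟩ -
            WithLp.ofLp (HkE P w c' k (toEj P k (Pi.single b' 1))) ⟨q.src, q.μ⟩) := by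
      simp only [curl, smul_eq_mul]; ring
    rw [e]
    have h2 := hgrad b' q.src q.μ q.ν
    have h3 := hgrad b' q.src q.ν q.μ
    refine (abs_sub _ _).trans ?_
    linarith
  have hcut := isCutoff_cutoff (show r / 16 < r / 8 by linarith) (fun (b : PBond P 0) (b' : PBond P k) => distEU P k b.src b'.src)
  have h01 := cutoff_mem_Icc (r / 16) (r / 8) (fun (b : PBond P 0) (b' : PBond P k) => distEU P k b.src b'.src)
  have hLipζ : ∀ (x x' : TSite P 0) (lam lam' : Fin P.d) (b' : PBond P k), supDist x x' ≤ 1 →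
      (P.L : ℝ) ^ k * |cutoff (r / 16) (r / 8) (fun (b : PBond P 0) (b' : PBond P k) => distEU P k b.src b'.src) ⟨x, lam⟩ b' -
        cutoff (r / 16) (r / 8) (fun (b : PBond P 0) (b' : PBond P k) => distEU P k b.src b'.src) ⟨x', lam'⟩ b'| ≤ C :=
    fun x x' lam lam' b' hxx' => lip_cutoff_torus hC.le hr16 (hLip₀ (r / 16) (r / 8) (by linarith)) x x' lam lam' b' hxx'
  have hsmall : A * Real.exp (-(δ / 2 * (r / 16))) ≤ Real.exp (-(δ / 64 * r)) := by
    have h := small_of_le_mul hAr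
    have e : -(2 * (δ / 64) * r) = -(δ / 2 * (r / 16)) := by ring
    rwa [e] at h
  have hPd' : (P.d : ℝ) = d := by exact_mod_cast hPd
  refine ⟨fun b b' => ?_, fun q b' => ?_, fun x b' => ?_⟩
  · exact member_of_bound hδ hsmall hMA (distEU_nonneg' k _ _) (hχ₀ b.src) fun hb =>
      abs_hkPart_le (H := fun b' => WithLp.ofLp (HkE P w c' k (toEj P k (Pi.single b' 1)))) hδ.le hM0 hH hr0 hcut h01 hχb hbox hb b'
  · exact member_of_bound hδ hsmall hA1 (distEU_nonneg' k _ _) (hχ₀ q.src) fun hq =>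
      abs_curl_hkPart_le (H := fun b' => WithLp.ofLp (HkE P w c' k (toEj P k (Pi.single b' 1)))) hδ.le hM0 hH hcurl hr0 hC.le hcut h01
        hLipζ hχb hbox hq b'
  · refine member_of_bound hδ hsmall hA2 (distEU_nonneg' k _ _) (hχ₀ x) fun hx => ?_
    have h := abs_diverg_hkPart_le (H := fun b' => WithLp.ofLp (HkE P w c' k (toEj P k (Pi.single b' 1)))) hδ.le hM0 hH hgrad hr0 hC.le
      hcut h01 hLipζ hχb hbox hx b'
    rw [hPd'] at h
    exact h

end

end Literature.MathematicalPhysics.QuantumFieldTheory.BalabanImbrieJaffe1984to88.BIJ88W1HkPart544DivTorus
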